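import Summits.MatrixMultiplication.MatrixMultiplication.Theorems.SoloInformedOneFibreCounterexample

/-!
# The tiny host `S⁰ × ℤ/3`: support calculus behind Proposition T

This work, §8.7 (d). For the smallest fixed-point host family — translation schemes
`𝒮(S⁰ × ℤ/3, ⟨(1,-1)⟩)`, `S⁰` an arbitrary finite abelian group (unbounded exponent, a third of `S`
fixed, so that neither Theorem B″ nor Theorem C2 applies) — Proposition T of the dossier gives
`|S⁰| ≥ n³/14` and `rank ≥ n³/7` for every realization of `⟨n,n,n⟩`; the construction of §8.3
(`|S⁰| = n³/2`, rank `n³`) shows the order is right. Over `S¹ = ℤ/3` with multipliers `±1` the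
triangle equations (E) and separation (Sep) depend only on SUPPORTS:

* `triangle_iff`: a pattern solves `u ± v ± w = 0` iff NOT exactly one of `u, v, w` is nonzero;
* `mixed_nonvanishing_iff`: all four mixed sums `u ± v ± w` are nonzero iff EXACTLY one is nonzero.

From (E) alone follows the ZERO CLOSURE (Z): two zero cells of a matrix-multiplication triple force
the third (`zero_closure₁₂₃`; true over every host, the multipliers being automorphisms — here it is
read off the table). The three combinatorial steps of Proposition T are then:
(i) triples with `a ≠ 0` and `c ≠ 0` are pairwise inseparable (`nonzero_inseparable`), so the triples
with three nonzero cells form a clique of the inseparability graph;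
(ii) no three triples of type `𝒵_c` (`a ≠ 0`, `c = 0`) are pairwise separated (`no_three_separated`);
(iii) inside the all-zero part `𝒪`, a cross zero `a(i_s, j_t) = 0` makes `τ_s, τ_t` inseparable, and so
does a common row / column / pile of their zero boxes (`allzero_inseparable_of_cross`,
`allzero_inseparable_of_common_row|col|pile`) — the zero boxes of the all-zero members of one fibre
are pairwise coordinate-disjoint. The count `N₀ ≥ n³/14` is bookkeeping over (i)–(iii) (dossier
§8.7 (d)). References: this work §8.7; CohnUmans2013 (arXiv:1207.6528) Def. 12.
-/

namespace Summit.MatrixMultiplication.MatrixMultiplication.Theorems.TwistedTPP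

namespace TinyHost

/-- Over `(ℤ/3, ±)` a twisted triangle `u ± v ± w = 0` exists iff NOT exactly one entry is nonzero.
[this work, §8.7] -/
theorem triangle_iff (u v w : ZMod 3) :
    (u + v + w = 0 ∨ u + v - w = 0 ∨ u - v + w = 0 ∨ u - v - w = 0) ↔
    ¬ ((u ≠ 0 ∧ v = 0 ∧ w = 0) ∨ (u = 0 ∧ v ≠ 0 ∧ w = 0) ∨ (u = 0 ∧ v = 0 ∧ w ≠ 0)) := by
  revert u v w
  decide

/-- Over `(ℤ/3, ±)` all four mixed sums `u ± v ± w` are nonzero iff EXACTLY one entry is nonzero.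
[this work, §8.7] -/
theorem mixed_nonvanishing_iff (u v w : ZMod 3) :
    (u + v + w ≠ 0 ∧ u + v - w ≠ 0 ∧ u - v + w ≠ 0 ∧ u - v - w ≠ 0) ↔
    ((u ≠ 0 ∧ v = 0 ∧ w = 0) ∨ (u = 0 ∧ v ≠ 0 ∧ w = 0) ∨ (u = 0 ∧ v = 0 ∧ w ≠ 0)) := by
  revert u v w
  decide

/-- Support data over the tiny host: three `ℤ/3`-valued matrices satisfying the triangle equations
(E) — some sign pattern closes every matrix-multiplication triple. [this work, §8.7] -/
structure Data (G : Type*) where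
  /-- `S¹`-component of the first class map. -/
  a : G → G → ZMod 3
  /-- `S¹`-component of the second class map. -/
  b : G → G → ZMod 3
  /-- `S¹`-component of the third class map. -/
  c : G → G → ZMod 3
  /-- (E): every matrix-multiplication triple closes up for some sign pattern. -/
  eqn : ∀ i j k, a i j + b j k + c k i = 0 ∨ a i j + b j k - c k i = 0 ∨
    a i j - b j k + c k i = 0 ∨ a i j - b j k - c k i = 0

variable {G : Type*} (D : Data G)

/-- (Z1): `a(i,j) = 0 ∧ b(j,k) = 0 ⟹ c(k,i) = 0`. [this work, §8.7] -/
theorem zero_closure₁ {i j k : G} (ha : D.a i j = 0) (hb : D.b j k = 0) : D.c k i = 0 := by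
  have h := (triangle_iff _ _ _).1 (D.eqn i j k)
  by_contra hc
  exact h (Or.inr (Or.inr ⟨ha, hb, hc⟩))

/-- (Z2): `b(j,k) = 0 ∧ c(k,i) = 0 ⟹ a(i,j) = 0`. [this work, §8.7] -/
theorem zero_closure₂ {i j k : G} (hb : D.b j k = 0) (hc : D.c k i = 0) : D.a i j = 0 := by
  have h := (triangle_iff _ _ _).1 (D.eqn i j k)
  by_contra ha
  exact h (Or.inl ⟨ha, hb, hc⟩)

/-- (Z3): `c(k,i) = 0 ∧ a(i,j) = 0 ⟹ b(j,k) = 0`. [this work, §8.7] -/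
theorem zero_closure₃ {i j k : G} (hc : D.c k i = 0) (ha : D.a i j = 0) : D.b j k = 0 := by
  have h := (triangle_iff _ _ _).1 (D.eqn i j k)
  by_contra hb
  exact h (Or.inr (Or.inl ⟨ha, hb, hc⟩))

/-- (i) Triples `τ = (i,j,k)`, `τ' = (i',j',k')` with `a(i,j) ≠ 0` and `c(k',i') ≠ 0` are never
separated in the direction `τ ← τ'`: the mixed cells `(i,j), (j',k), (k',i')` carry at least two nonzero
values. In particular the triples with three nonzero cells form a clique of the inseparability graph,
so a fibre of a realization contains at most one of them. [this work, §8.7] -/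
theorem nonzero_inseparable {i j k i' j' k' : G} (ha : D.a i j ≠ 0) (hc : D.c k' i' ≠ 0) :
    ¬ (D.a i j + D.b j' k + D.c k' i' ≠ 0 ∧ D.a i j + D.b j' k - D.c k' i' ≠ 0 ∧
       D.a i j - D.b j' k + D.c k' i' ≠ 0 ∧ D.a i j - D.b j' k - D.c k' i' ≠ 0) := by
  rw [mixed_nonvanishing_iff]
  rintro (⟨_, _, h⟩ | ⟨h, _, _⟩ | ⟨h, _, _⟩)
  · exact hc h
  · exact ha h
  · exact ha h

/-- Separation in the direction `τ₁ ← τ₂` with `a(i₁,j₁) ≠ 0` kills the cross cell `b(j₂, k₁)`.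
[this work, §8.7] -/
theorem cross_b_zero_of_sep {i₁ j₁ k₁ i₂ j₂ k₂ : G} (ha : D.a i₁ j₁ ≠ 0)
    (h : D.a i₁ j₁ + D.b j₂ k₁ + D.c k₂ i₂ ≠ 0 ∧ D.a i₁ j₁ + D.b j₂ k₁ - D.c k₂ i₂ ≠ 0 ∧
      D.a i₁ j₁ - D.b j₂ k₁ + D.c k₂ i₂ ≠ 0 ∧ D.a i₁ j₁ - D.b j₂ k₁ - D.c k₂ i₂ ≠ 0) :
    D.b j₂ k₁ = 0 := by
  rw [mixed_nonvanishing_iff] at h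
  rcases h with ⟨_, hb, _⟩ | ⟨h0, _, _⟩ | ⟨h0, _, _⟩
  · exact hb
  · exact (ha h0).elim
  · exact (ha h0).elim

/-- (ii) **No three triples of type `𝒵_c` are pairwise separated.** If `τ₁ = (i₁,j₁,k₁)` has
`a(i₁,j₁) ≠ 0`, `c(k₁,i₁) = 0`, `τ₃` has `a(i₃,j₃) ≠ 0`, and the three ordered pairs `τ₁ ← τ₂`,
`τ₃ ← τ₂`, `τ₃ ← τ₁` are separated, then the zero closure forces `a(i₁,j₁) = 0`. Hence a fibre of any
realization holds at most two triples of type `𝒵_c` (and, cyclically, of types `𝒵_a`, `𝒵_b`).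
[this work, §8.7] -/
theorem no_three_separated {i₁ j₁ k₁ i₂ j₂ k₂ i₃ j₃ k₃ : G}
    (ha₁ : D.a i₁ j₁ ≠ 0) (hc₁ : D.c k₁ i₁ = 0) (ha₃ : D.a i₃ j₃ ≠ 0)
    (h₁₂ : D.a i₁ j₁ + D.b j₂ k₁ + D.c k₂ i₂ ≠ 0 ∧ D.a i₁ j₁ + D.b j₂ k₁ - D.c k₂ i₂ ≠ 0 ∧
      D.a i₁ j₁ - D.b j₂ k₁ + D.c k₂ i₂ ≠ 0 ∧ D.a i₁ j₁ - D.b j₂ k₁ - D.c k₂ i₂ ≠ 0)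
    (h₃₂ : D.a i₃ j₃ + D.b j₂ k₃ + D.c k₂ i₂ ≠ 0 ∧ D.a i₃ j₃ + D.b j₂ k₃ - D.c k₂ i₂ ≠ 0 ∧
      D.a i₃ j₃ - D.b j₂ k₃ + D.c k₂ i₂ ≠ 0 ∧ D.a i₃ j₃ - D.b j₂ k₃ - D.c k₂ i₂ ≠ 0)
    (h₃₁ : D.a i₃ j₃ + D.b j₁ k₃ + D.c k₁ i₁ ≠ 0 ∧ D.a i₃ j₃ + D.b j₁ k₃ - D.c k₁ i₁ ≠ 0 ∧
      D.a i₃ j₃ - D.b j₁ k₃ + D.c k₁ i₁ ≠ 0 ∧ D.a i₃ j₃ - D.b j₁ k₃ - D.c k₁ i₁ ≠ 0) : False := by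
  have hb₂₁ : D.b j₂ k₁ = 0 := cross_b_zero_of_sep D ha₁ h₁₂
  have ha₁₂ : D.a i₁ j₂ = 0 := zero_closure₂ D hb₂₁ hc₁
  have hb₂₃ : D.b j₂ k₃ = 0 := cross_b_zero_of_sep D ha₃ h₃₂
  have hc₃₁ : D.c k₃ i₁ = 0 := zero_closure₁ D ha₁₂ hb₂₃
  have hb₁₃ : D.b j₁ k₃ = 0 := cross_b_zero_of_sep D ha₃ h₃₁
  exact ha₁ (zero_closure₂ D hb₁₃ hc₃₁)

/-- (iii) Inside the all-zero part `𝒪`: if `τ₁ = (i₁,j₁,k₁)` has `a(i₁,j₁) = 0 = c(k₁,i₁)`, `τ₂` has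
`c(k₂,i₂) = 0`, and the CROSS cell vanishes, `a(i₁,j₂) = 0`, then `τ₁ ← τ₂` is not separated.
[this work, §8.7] -/
theorem allzero_inseparable_of_cross {i₁ j₁ k₁ i₂ j₂ k₂ : G} (ha₁ : D.a i₁ j₁ = 0)
    (hc₁ : D.c k₁ i₁ = 0) (hc₂ : D.c k₂ i₂ = 0) (hcross : D.a i₁ j₂ = 0) :
    ¬ (D.a i₁ j₁ + D.b j₂ k₁ + D.c k₂ i₂ ≠ 0 ∧ D.a i₁ j₁ + D.b j₂ k₁ - D.c k₂ i₂ ≠ 0 ∧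
       D.a i₁ j₁ - D.b j₂ k₁ + D.c k₂ i₂ ≠ 0 ∧ D.a i₁ j₁ - D.b j₂ k₁ - D.c k₂ i₂ ≠ 0) := by
  have hb : D.b j₂ k₁ = 0 := zero_closure₃ D hc₁ hcross
  rw [ha₁, hb, hc₂]
  decide

/-- (iii, rows) Two all-zero triples whose zero boxes share a ROW `i` (`a(i,j₁) = 0 = a(i,j₂)`) are
inseparable. [this work, §8.7] -/
theorem allzero_inseparable_of_common_row {i₁ j₁ k₁ i₂ j₂ k₂ i : G} (ha₁ : D.a i₁ j₁ = 0)
    (hb₁ : D.b j₁ k₁ = 0) (hc₂ : D.c k₂ i₂ = 0) (hr₁ : D.a i j₁ = 0) (hr₂ : D.a i j₂ = 0) :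
    ¬ (D.a i₁ j₁ + D.b j₂ k₁ + D.c k₂ i₂ ≠ 0 ∧ D.a i₁ j₁ + D.b j₂ k₁ - D.c k₂ i₂ ≠ 0 ∧
       D.a i₁ j₁ - D.b j₂ k₁ + D.c k₂ i₂ ≠ 0 ∧ D.a i₁ j₁ - D.b j₂ k₁ - D.c k₂ i₂ ≠ 0) := by
  have hci : D.c k₁ i = 0 := zero_closure₁ D hr₁ hb₁
  have hb : D.b j₂ k₁ = 0 := zero_closure₃ D hci hr₂
  rw [ha₁, hb, hc₂]
  decide

/-- (iii, columns) Two all-zero triples whose zero boxes share a COLUMN `j` (`a(i₁,j) = 0 = a(i₂,j)`)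
are inseparable. [this work, §8.7] -/
theorem allzero_inseparable_of_common_col {i₁ j₁ k₁ i₂ j₂ k₂ j : G} (ha₁ : D.a i₁ j₁ = 0)
    (hc₁ : D.c k₁ i₁ = 0) (hb₂ : D.b j₂ k₂ = 0) (hc₂ : D.c k₂ i₂ = 0)
    (hq₁ : D.a i₁ j = 0) (hq₂ : D.a i₂ j = 0) :
    ¬ (D.a i₁ j₁ + D.b j₂ k₁ + D.c k₂ i₂ ≠ 0 ∧ D.a i₁ j₁ + D.b j₂ k₁ - D.c k₂ i₂ ≠ 0 ∧
       D.a i₁ j₁ - D.b j₂ k₁ + D.c k₂ i₂ ≠ 0 ∧ D.a i₁ j₁ - D.b j₂ k₁ - D.c k₂ i₂ ≠ 0) := by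
  have hb₂' : D.b j k₂ = 0 := zero_closure₃ D hc₂ hq₂
  have hc₂₁ : D.c k₂ i₁ = 0 := zero_closure₁ D hq₁ hb₂'
  have hcross : D.a i₁ j₂ = 0 := zero_closure₂ D hb₂ hc₂₁
  exact allzero_inseparable_of_cross D ha₁ hc₁ hc₂ hcross

/-- (iii, piles) Two all-zero triples whose zero boxes share a PILE `k` (`b(j₁,k) = 0 = b(j₂,k)`) are
inseparable (in the direction `τ₂ ← τ₁`). [this work, §8.7] -/
theorem allzero_inseparable_of_common_pile {i₁ j₁ k₁ i₂ j₂ k₂ k : G}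
    (hc₁ : D.c k₁ i₁ = 0) (ha₂ : D.a i₂ j₂ = 0) (hc₂ : D.c k₂ i₂ = 0)
    (hp₁ : D.b j₁ k = 0) (hp₂ : D.b j₂ k = 0) :
    ¬ (D.a i₂ j₂ + D.b j₁ k₂ + D.c k₁ i₁ ≠ 0 ∧ D.a i₂ j₂ + D.b j₁ k₂ - D.c k₁ i₁ ≠ 0 ∧
       D.a i₂ j₂ - D.b j₁ k₂ + D.c k₁ i₁ ≠ 0 ∧ D.a i₂ j₂ - D.b j₁ k₂ - D.c k₁ i₁ ≠ 0) := by
  have hck : D.c k i₂ = 0 := zero_closure₁ D ha₂ hp₂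
  have hcross : D.a i₂ j₁ = 0 := zero_closure₂ D hp₁ hck
  exact allzero_inseparable_of_cross D ha₂ hc₂ hc₁ hcross

/-- The §8.7 (a) toy is a model of the support calculus: its data satisfy (E).
[this work, §8.7] -/
def toyData (G : Type*) [DecidableEq G] : Data G where
  a := OneFibreToy.toyA
  b := OneFibreToy.toyB
  c := OneFibreToy.toyC
  eqn := fun i j k => OneFibreToy.toy_eqn i j k

end TinyHost

end Summit.MatrixMultiplication.MatrixMultiplication.Theorems.TwistedTPP
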